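import Summits.QuantumFields.YangMills.Theorems.AlphaInputsT3ACData
import Literature.MathematicalPhysics.QuantumFieldTheory.Balaban1983to89.BlockAveragingPlaquetteBound
import HarnessLib

/-!
# `AlphaInputsT3AC` — bridge note (finding F-α1-3 in kernel form): the interface's `Adm`-conditioned MINIMISER ROWS AT THE TRIVIAL HISTORY,
# read on a datum for which the trivial history is ALWAYS admissible, force EVERY level-1 datum into a window of radius
# `(151L²)·C68·θBal(K − 1)·L^{−2}` — i.e. they are jointly unsatisfiable at large `K` (the radius tends to `0`, data do not)

Lane `pub-balaban3d`, seat alpha-1 (LINE 2 of `defn-AlphaInputsT3AC`, route `UnitScaleTilt`); a DESIGN NOTE for the interface pen / route owner,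
kernel-checked so that it can be cited.  The Literature interface `T3AlphaInputsAC` conditions `Constraint42Top` ((42)/(67): `avg^j(U_j(h,W)) = W`
on `Ω_j(h)`) and `Regularity68` ((68): the composite minimiser is `C68·θ(K−i)·L^{−2i}`-regular under `Λ_i(h)`) on the admissibility predicate
`Adm K j h W`.  For the assembled datum `AlphaInputsT3AC.Of.dataT3` (`Adm :=` support of the Radon–Nikodym masses, the only choice on which the
lane's `LF = Σ_h m·e^Φ` charges) the trivial history is admissible at EVERY datum (`dataT3_adm_triv`: the lane floors the trivial mass at `1`,
`MassesAC.one_le_massRecAC_triv`), and its regions are the whole torus (`dataT3_trivRegions`).  THEN (this file):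

* `plaqSmall_of_trivRows` — for ANY `D : AlphaDataT3 F γ` with `TrivRegions D` and `Adm K j triv W` for all `W`: `Constraint42Top D ∧ Regularity68 D
  b₀ p₀ C68` imply that every level-1 datum `W` of run `K ≥ 1` is `(L² + 6(5L)²)·a`-small for every `a > C68·θBal(K−1)·L^{−2}` in the range of
  the averaging bound (`(5L)²a/4 < δ₂ = 1/3`) — by (68) at `(triv, i = j = 1)` every fine plaquette of `U_1(triv, W)` is within `a` of `1`, by the
  tree's [Balaban1985Averaging] Prop. 1 for the `(0.4)`/`exp[mean log]` averaging (`BlockAveragingPlaquetteBound.plaqSmall_blockAvg_expMeanLogSU`)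
  its block average is `(151L²)a`-small, and by (42) at `(triv, j = 1)` that block average IS `W`;
* `AlphaInputsT3AC.Of.dataT3_plaqSmall_of_trivRows` — the same for `dataT3` (hypotheses discharged by `dataT3_trivRegions`/`dataT3_adm_triv`).
Since `θBal(K − 1) = g_1p(g_1) → 0` (`g_1² = γL^{1−K}`) while level-1 data with a plaquette at any fixed distance from `1` exist for every `K`, the
v1.1 package `T3AlphaInputsACSchemas.AlphaInputsT3AC (dataT3 …) b₀ p₀ ε₀ C68` fails for all large `K`.  REPAIRS (not made here): (a) interface —
condition the trivial-history instances of the minimiser rows on the datum window `PlaqSmall (θBal (K − j)) W` (print's `χ_k`-support, (47)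
p.267); (b) lane — un-floor the trivial mass to print's characteristic function.  Nothing of [Balaban1985UV3] is asserted; the theorems are
implications between hypothesis schemas.

References: T. Bałaban, Commun. Math. Phys. 102 (1985) 255–275 [Balaban1985UV3], (42) p.266, (47) p.267, (67)–(68) p.273; Commun. Math. Phys.
98 (1985) 17–51 [Balaban1985Averaging], Prop. 1 p.26.
-/

set_option autoImplicit false

noncomputable section

namespace Summit.QuantumFields.YangMills.Theorems

open MeasureTheory
open Literature.MathematicalPhysics.QuantumFieldTheory.Balaban1983to89
open Literature.MathematicalPhysics.QuantumFieldTheory.Balaban1983to89.T3ContinuumYM3Torus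
open Literature.MathematicalPhysics.QuantumFieldTheory.Balaban1983to89.T3UnitLawDensityEML (ℰp)
open Literature.MathematicalPhysics.QuantumFieldTheory.Balaban1983to89.T3UnitScaleTilt (θBal)
open Literature.MathematicalPhysics.QuantumFieldTheory.Balaban1983to89.T3AlphaInputsAC
open Literature.MathematicalPhysics.QuantumFieldTheory.Balaban1983to89.B10Eq38TorusDomains (plaqsIn mem_plaqsIn_iff)
open Literature.MathematicalPhysics.QuantumFieldTheory.Balaban1983to89.B10Eq42TorusConstraint (bondsIn lam42 mem_bondsIn_iff)
open Literature.MathematicalPhysics.QuantumFieldTheory.Balaban1983to89.ExpMeanLog (deltaSU expMeanLogSU)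
open Literature.MathematicalPhysics.QuantumFieldTheory.Balaban1983to89.BlockAveragingPlaquetteBound (plaqSmall_blockAvg_expMeanLogSU)
open Summit.QuantumFields.Balaban3D.Carriers
open Summit.QuantumFields.Balaban3D.Proofs.Primitives

variable {F : T3Family} {γ : ℝ}

/-- **THE TRIVIAL-HISTORY MINIMISER ROWS SQUEEZE EVERY LEVEL-1 DATUM** (finding F-α1-3): for a datum `D` whose trivial regions are the whole torus
and whose trivial history is admissible at every datum, `Constraint42Top D` and `Regularity68 D b₀ p₀ C68` imply: for every run `K ≥ 1`, every
`a ≥ 0` with `C68·θBal(K−1)·(L¹)⁻² < a` and `(5L)²a/4 < δ₂`, EVERY level-1 datum `W` is `(L² + 6(5L)²)·a`-small — (68) at `(triv, 1, 1)` +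
[Balaban1985Averaging] Prop. 1 (tree, for `blockAvg ℰp`) + (42) at `(triv, 1)`. [cite: Balaban1985UV3, (42) p.266 and (68) p.273] -/
theorem plaqSmall_of_trivRows {D : AlphaDataT3 F γ} {b₀ p₀ C68 : ℝ} (hΩ : TrivRegions D)
    (hadm : ∀ K j (W : GaugeField (F.P K) j (Matrix.specialUnitaryGroup (Fin 2) ℂ)), D.Adm K j (D.triv K j) W)
    (h42 : Constraint42Top D) (h68 : Regularity68 D b₀ p₀ C68) (K : ℕ) (hK : 1 ≤ K) {a : ℝ} (ha : 0 ≤ a)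
    (hθ : C68 * θBal F.L γ b₀ p₀ (K - 1) * (((F.L : ℝ) ^ 1)⁻¹) ^ 2 < a)
    (ht : (((((F.P K).d + 2) * (F.P K).L : ℕ) : ℝ) ^ 2 / 4) * a < deltaSU (Fin 2))
    (W : GaugeField (F.P K) 1 (Matrix.specialUnitaryGroup (Fin 2) ℂ)) :
    PlaqSmall ((((F.P K).L : ℝ) ^ 2 + 6 * (((((F.P K).d + 2) * (F.P K).L : ℕ) : ℝ)) ^ 2) * a) W := by
  -- the composite minimiser at the trivial history
  set U := D.Umin K 1 (D.triv K 1) W with hU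
  -- (68) at (triv, i = j = 1): every fine plaquette of `U` is `a`-small (`Λ_1(triv) = Ω_1(triv) = univ`)
  have hsmall : PlaqSmall a U := by
    intro q
    have hΛ : D.Λ K 1 (D.triv K 1) 1 = Set.univ := by
      show lam42 (D.Ω K 1 (D.triv K 1)) 1 1 = Set.univ
      unfold lam42
      rw [if_neg (lt_irrefl 1), hΩ K 1 1]
    have hq : q ∈ plaqsIn 0 (D.Λ K 1 (D.triv K 1) 1) := by
      rw [hΛ, mem_plaqsIn_iff]
      exact Set.subset_univ _
    exact lt_of_le_of_lt (h68 K 1 (D.triv K 1) W hK (hadm K 1 W) 1 le_rfl q hq) hθ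
  -- Prop. 1 for the (0.4)/exp[mean log] averaging
  have hm : 0 + 1 ≤ (F.P K).m + (F.P K).K := by
    show 0 + 1 ≤ F.m + K
    omega
  have havg := plaqSmall_blockAvg_expMeanLogSU (n := Fin 2) hm ha hsmall ht
  -- (42) at (triv, j = 1): the block average of `U` is `W`
  have hW : (BlockAveraging.blockAvg (P := F.P K) (j := 0) (expMeanLogSU (n := Fin 2))).avg U = W := by
    funext b
    have hb : b ∈ bondsIn 1 (D.Ω K 1 (D.triv K 1) 1) := by
      rw [hΩ K 1 1, mem_bondsIn_iff]
      exact ⟨Set.mem_univ _, Set.mem_univ _⟩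
    exact h42 K 1 (D.triv K 1) W hK (hadm K 1 W) b hb
  rw [hW] at havg
  exact havg

variable {𝔠 : AlphaConsts F.L (suGroupModel 2).N}
  (h : AlphaInputsT3AC.Of F 𝔠) (γ' : ℝ) (hγ : 0 < γ') (hγ1 : γ' ≤ (min 𝔠.gamma0 1) ^ 2) (π : AlphaInputsT3AC.PolymerT3 F)

/-- **THE SAME FOR THE ASSEMBLED DATUM `dataT3`** (its trivial regions are the torus, `dataT3_trivRegions`, and its trivial history is admissible
at every datum, `dataT3_adm_triv`): under `Constraint42Top ∧ Regularity68 … C68` every level-1 datum of run `K ≥ 1` is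
`(L² + 6(5L)²)·a`-small for every admissible radius `a > C68·θBal(K−1)·L^{−2}` — the two rows, as conditioned in v1.1, cannot both hold for the
lane's construction at large `K`. [cite: Balaban1985UV3, (42) p.266 and (68) p.273] -/
theorem AlphaInputsT3AC.Of.dataT3_plaqSmall_of_trivRows {b₀ p₀ C68 : ℝ}
    (h42 : Constraint42Top (h.dataT3 γ' hγ hγ1 π)) (h68 : Regularity68 (h.dataT3 γ' hγ hγ1 π) b₀ p₀ C68)
    (K : ℕ) (hK : 1 ≤ K) {a : ℝ} (ha : 0 ≤ a) (hθ : C68 * θBal F.L γ' b₀ p₀ (K - 1) * (((F.L : ℝ) ^ 1)⁻¹) ^ 2 < a)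
    (ht : (((((F.P K).d + 2) * (F.P K).L : ℕ) : ℝ) ^ 2 / 4) * a < deltaSU (Fin 2))
    (W : GaugeField (F.P K) 1 (Matrix.specialUnitaryGroup (Fin 2) ℂ)) :
    PlaqSmall ((((F.P K).L : ℝ) ^ 2 + 6 * (((((F.P K).d + 2) * (F.P K).L : ℕ) : ℝ)) ^ 2) * a) W :=
  plaqSmall_of_trivRows (h.dataT3_trivRegions γ' hγ hγ1 π) (fun K j W => h.dataT3_adm_triv γ' hγ hγ1 π K j W) h42 h68 K hK ha hθ ht W

end Summit.QuantumFields.YangMills.Theorems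

end
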